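import Mathlib
import Summits.NavierStokesRegularity.NavierStokesRegularity.Theorems.EulerZoomLiouvillePowerGaugeEulerLiouvilleMirrorMomentTransport
import HarnessLib

/-!
# Crux `EulerZoomLiouville.PowerGaugeEulerLiouville` (stmt-NavierStokesRegularity-19832), line `mirror-moment`, stub M1 — time side, part 3a:
# TIME-DEPENDENT TEST WEIGHTS FOR THE TRANSPORT OF `ω_θ/r` (balance identity and the bracket `⟨x⟩ = √(1+|x|²)`)

Route №10 `EulerZoomLiouville` (NavierStokesRegularity), crux E, line `mirror-moment`, stub `stub_momentMonotone` (M1).  Seat ns-sfl-p1 g3.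
Part 2 (`…MirrorMomentMonotone`) proved the monotonicity of the axial ledger moment modulo ONE a priori clause: the weighted ledger moment
`∫ (1+‖x‖) η(τ,x) dx` is LOCALLY BOUNDED IN TIME.  Parts 3a/3b derive that clause from the registered predicate (finite moment slice by
slice + speed bound `‖u‖ ≤ B` on compact slabs) by testing the transport `∂ₜΩ = −DΩ[u]` against MOVING weights that are supersolutions of
the transport (`∂ₜZ + DZ[u] ≤ 0`): mass moves at speed at most `B`.  This file provides the calculus:

* `integral_family_mul_angVortQuot_eq_add` — for a jointly smooth, compactly supported (in `x`, uniformly on the slab) weight family `Z`: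
  `∫ Z(t)Ω(t) − ∫ Z(s)Ω(s) = ∫ₛᵗ ∫ Ω (∂ₜZ + DZ[v]) dx dτ` (product rule on time lines + part 1's `integral_weight_mul_timeDerivWithin_angVortQuot`);
* `bracket` facts — `⟨x⟩ = √(1 + ‖x‖²)`: smooth, `1 ≤ ⟨x⟩`, `‖x‖ ≤ ⟨x⟩ ≤ 1 + ‖x‖`, derivative `h ↦ ⟪x, h⟫/⟨x⟩` of norm `≤ ‖h‖`.

WHAT THIS IS NOT: not NS, not the crux E — helper `--supports` stmt-19832 (calculus for ONE stratum lemma); 19832 OPEN.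
[cite: MajdaBertozziCUP2002, §2.3.3 (2.58)–(2.59)]
-/

noncomputable section

-- flat `Theorems/<Route><Decl>…` files of one crux share the namespace of the crux (tree convention)
set_option linter.dupNamespace false

open MeasureTheory Set Filter Topology Metric Function
open scoped NNReal ENNReal RealInnerProductSpace

namespace Summit.NavierStokesRegularity.NavierStokesRegularity.Theorems.PowerGaugeEulerLiouville.MirrorMoment

open Literature.Analysis Literature.Analysis.FluidPDE
open Summit.NavierStokesRegularity.NavierStokesRegularity.Theorems.PowerGaugeEulerLiouville.AxisymNoSwirl

/-! ### The bracket `⟨x⟩ = √(1 + ‖x‖²)` -/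

/-- `1 + ‖x‖² > 0`. [folklore] -/
theorem one_add_norm_sq_pos (x : EuclideanSpace ℝ (Fin 3)) : 0 < 1 + ‖x‖ ^ 2 := by positivity

/-- `⟨x⟩ = √(1 + ‖x‖²)` is smooth. [folklore] -/
theorem contDiff_bracket {n : ℕ∞} : ContDiff ℝ n fun x : EuclideanSpace ℝ (Fin 3) => Real.sqrt (1 + ‖x‖ ^ 2) :=
  (contDiff_const.add (contDiff_norm_sq ℝ)).sqrt fun x => (one_add_norm_sq_pos x).ne'

/-- `1 ≤ ⟨x⟩`, `‖x‖ ≤ ⟨x⟩`, `⟨x⟩ ≤ 1 + ‖x‖`. [folklore] -/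
theorem bracket_bounds (x : EuclideanSpace ℝ (Fin 3)) :
    1 ≤ Real.sqrt (1 + ‖x‖ ^ 2) ∧ ‖x‖ ≤ Real.sqrt (1 + ‖x‖ ^ 2) ∧ Real.sqrt (1 + ‖x‖ ^ 2) ≤ 1 + ‖x‖ := by
  refine ⟨?_, ?_, ?_⟩
  · exact Real.one_le_sqrt.2 (by nlinarith [norm_nonneg x])
  · calc ‖x‖ = Real.sqrt (‖x‖ ^ 2) := (Real.sqrt_sq (norm_nonneg _)).symm
      _ ≤ Real.sqrt (1 + ‖x‖ ^ 2) := Real.sqrt_le_sqrt (by linarith)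
  · rw [Real.sqrt_le_left (by positivity)]
    nlinarith [norm_nonneg x]

/-- The derivative of the bracket: `D⟨·⟩(x) = ⟨x⟩⁻¹ ⟪x, ·⟫`, i.e. `h ↦ ⟪x,h⟫/⟨x⟩`. [folklore] -/
theorem hasFDerivAt_bracket (x : EuclideanSpace ℝ (Fin 3)) :
    HasFDerivAt (fun y : EuclideanSpace ℝ (Fin 3) => Real.sqrt (1 + ‖y‖ ^ 2))
      ((Real.sqrt (1 + ‖x‖ ^ 2))⁻¹ • innerSL ℝ x) x := by
  have h1 : HasFDerivAt (fun y : EuclideanSpace ℝ (Fin 3) => 1 + ‖y‖ ^ 2) (2 • innerSL ℝ x) x := by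
    have h := ((hasFDerivAt_id x).norm_sq).const_add 1
    simpa using h
  have h2 := h1.sqrt (one_add_norm_sq_pos x).ne'
  have e : (1 / (2 * Real.sqrt (1 + ‖x‖ ^ 2))) • ((2 : ℕ) • innerSL ℝ x) = (Real.sqrt (1 + ‖x‖ ^ 2))⁻¹ • innerSL ℝ x := by
    rw [two_nsmul, ← two_smul ℝ, smul_smul]
    congr 1
    field_simp
  rw [← e]
  exact h2

/-- `|D⟨·⟩(x)[h]| ≤ ‖h‖` (Cauchy–Schwarz and `‖x‖ ≤ ⟨x⟩`). [folklore] -/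
theorem abs_fderiv_bracket_le (x h : EuclideanSpace ℝ (Fin 3)) :
    |fderiv ℝ (fun y : EuclideanSpace ℝ (Fin 3) => Real.sqrt (1 + ‖y‖ ^ 2)) x h| ≤ ‖h‖ := by
  rw [(hasFDerivAt_bracket x).fderiv]
  obtain ⟨h1, hxle, -⟩ := bracket_bounds x
  have hpos : 0 < Real.sqrt (1 + ‖x‖ ^ 2) := by linarith
  simp only [FunLike.coe_smul, Pi.smul_apply, innerSL_apply_apply, smul_eq_mul]
  rw [abs_mul, abs_inv, abs_of_pos hpos]
  calc (Real.sqrt (1 + ‖x‖ ^ 2))⁻¹ * |⟪x, h⟫| ≤ (Real.sqrt (1 + ‖x‖ ^ 2))⁻¹ * (‖x‖ * ‖h‖) := by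
        gcongr; exact abs_real_inner_le_norm x h
    _ ≤ (Real.sqrt (1 + ‖x‖ ^ 2))⁻¹ * (Real.sqrt (1 + ‖x‖ ^ 2) * ‖h‖) := by gcongr
    _ = ‖h‖ := by field_simp

/-! ### Product rule for the one-sided time derivative -/

/-- **Product rule on time lines**: for two jointly smooth scalar families on a time set of unique differentiability,
`∂ₜ(ZW) = (∂ₜZ) W + Z (∂ₜW)` pointwise. [folklore] -/
theorem timeDerivWithin_mul {S : Set ℝ} (hS : UniqueDiffOn ℝ S) {Z W : ℝ → EuclideanSpace ℝ (Fin 3) → ℝ}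
    (hZ : IsSmoothSpaceTimeOn S Z) (hW : IsSmoothSpaceTimeOn S W) {t : ℝ} (ht : t ∈ S) (x : EuclideanSpace ℝ (Fin 3)) :
    FluidPDE.timeDerivWithin S (fun σ y => Z σ y * W σ y) t x =
      FluidPDE.timeDerivWithin S Z t x * W t x + Z t x * FluidPDE.timeDerivWithin S W t x := by
  have h1 := hZ.hasDerivWithinAt_timeDerivWithin hS ht x
  have h2 := hW.hasDerivWithinAt_timeDerivWithin hS ht x
  rw [FluidPDE.timeDerivWithin_apply]
  exact (h1.mul h2).derivWithin (hS t ht)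

/-- The product of two jointly smooth scalar families is jointly smooth. [folklore] -/
theorem isSmoothSpaceTimeOn_mul {S : Set ℝ} {Z W : ℝ → EuclideanSpace ℝ (Fin 3) → ℝ}
    (hZ : IsSmoothSpaceTimeOn S Z) (hW : IsSmoothSpaceTimeOn S W) : IsSmoothSpaceTimeOn S fun σ y => Z σ y * W σ y := by
  have h : uncurry (fun σ y => Z σ y * W σ y) = fun q => uncurry Z q * uncurry W q := by
    funext q; rfl
  unfold IsSmoothSpaceTimeOn
  rw [h]
  exact ContDiffOn.mul hZ hW

/-! ### The balance identity for a time-dependent compactly supported weight -/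

/-- **Balance for moving weights.**  For a classical swirl-free axisymmetric Euler flow on `[0, T]` (`Ω = angVortQuot (v ·)`) and a weight
family `Z` jointly smooth on `[0, T] × ℝ³` whose slices vanish off a fixed compact `K`, for `0 ≤ s ≤ t ≤ T`:
`∫ Z(t,x)Ω(t,x) dx − ∫ Z(s,x)Ω(s,x) dx = ∫ₛᵗ ∫ Ω(τ,x) (∂ₜZ(τ,x) + DZ(τ,·)(x)[v(τ,x)]) dx dτ`
(product rule on the time lines + the transport tested against `Z(τ,·) ∈ C¹_c`). [cite: MajdaBertozziCUP2002, §2.3.3 (2.58)] -/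
theorem integral_family_mul_angVortQuot_eq_add {T : ℝ} (hT : 0 < T)
    {v : ℝ → EuclideanSpace ℝ (Fin 3) → EuclideanSpace ℝ (Fin 3)} {q : ℝ → EuclideanSpace ℝ (Fin 3) → ℝ}
    (hv : IsClassicalNSSolutionOn (Icc 0 T) 0 0 v q)
    (hax : ∀ σ ∈ Icc 0 T, IsAxisymmetric (v σ)) (hsw : ∀ σ ∈ Icc 0 T, HasNoSwirl (v σ))
    {Z : ℝ → EuclideanSpace ℝ (Fin 3) → ℝ} (hZ : IsSmoothSpaceTimeOn (Icc 0 T) Z)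
    {K : Set (EuclideanSpace ℝ (Fin 3))} (hK : IsCompact K) (hZK : ∀ σ ∈ Icc 0 T, ∀ x ∉ K, Z σ x = 0)
    {s t : ℝ} (hs : 0 ≤ s) (hst : s ≤ t) (ht : t ≤ T) :
    (∫ x, Z t x * angVortQuot (v t) x) - ∫ x, Z s x * angVortQuot (v s) x =
      ∫ τ in Ioo s t, ∫ x, angVortQuot (v τ) x *
        (FluidPDE.timeDerivWithin (Icc 0 T) Z τ x + fderiv ℝ (Z τ) x (v τ x)) := by
  have hU : UniqueDiffOn ℝ (Icc 0 T) := uniqueDiffOn_Icc hT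
  have hWfam : IsSmoothSpaceTimeOn (Icc 0 T) (fun σ => angVortQuot (v σ)) :=
    hv.smooth_velocity.angVortQuot_family (convex_Icc 0 T) hU
  have hP : IsSmoothSpaceTimeOn (Icc 0 T) (fun σ y => Z σ y * angVortQuot (v σ) y) := isSmoothSpaceTimeOn_mul hZ hWfam
  -- a fixed plateau equal to `1` on `K`
  obtain ⟨ρ, hρ⟩ : ∃ ρ : ℝ, K ⊆ closedBall (0 : EuclideanSpace ℝ (Fin 3)) ρ := hK.isBounded.subset_closedBall 0
  set ρ' : ℝ := max ρ 1 with hρ'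
  have hρ'0 : 0 < ρ' := lt_of_lt_of_le one_pos (le_max_right _ _)
  have hKρ' : K ⊆ closedBall (0 : EuclideanSpace ℝ (Fin 3)) ρ' := hρ.trans (closedBall_subset_closedBall (le_max_left _ _))
  set φ₀ : EuclideanSpace ℝ (Fin 3) → ℝ := cutoff (E := EuclideanSpace ℝ (Fin 3)) ρ' with hφ₀
  have hφ₀c : Continuous φ₀ := (contDiff_cutoff (n := 0) ρ').continuous
  have hφ₀s : HasCompactSupport φ₀ := hasCompactSupport_cutoff hρ'0
  have hφ₀K : ∀ x ∈ K, φ₀ x = 1 := fun x hx => cutoff_eq_one hρ'0 (mem_closedBall_zero_iff.1 (hKρ' hx))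
  -- the time lines off `K` vanish identically, hence so does `∂ₜZ`
  have hdZK : ∀ σ ∈ Icc 0 T, ∀ x ∉ K, FluidPDE.timeDerivWithin (Icc 0 T) Z σ x = 0 := by
    intro σ hσ x hx
    rw [FluidPDE.timeDerivWithin_apply]
    have heq : EqOn (fun σ' => Z σ' x) (fun _ => (0 : ℝ)) (Icc 0 T) := fun σ' hσ' => hZK σ' hσ' x hx
    rw [derivWithin_congr heq (hZK σ hσ x hx)]
    simp
  -- plateau insertion
  have hplat : ∀ σ ∈ Icc 0 T, ∀ x, φ₀ x * (Z σ x * angVortQuot (v σ) x) = Z σ x * angVortQuot (v σ) x := by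
    intro σ hσ x
    by_cases hx : x ∈ K
    · rw [hφ₀K x hx, one_mul]
    · rw [hZK σ hσ x hx, zero_mul, mul_zero]
  have hplat' : ∀ σ ∈ Icc 0 T, ∀ x, φ₀ x * FluidPDE.timeDerivWithin (Icc 0 T) (fun σ y => Z σ y * angVortQuot (v σ) y) σ x =
      FluidPDE.timeDerivWithin (Icc 0 T) Z σ x * angVortQuot (v σ) x +
        Z σ x * FluidPDE.timeDerivWithin (Icc 0 T) (fun σ => angVortQuot (v σ)) σ x := by
    intro σ hσ x
    rw [timeDerivWithin_mul hU hZ hWfam hσ x]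
    by_cases hx : x ∈ K
    · rw [hφ₀K x hx, one_mul]
    · rw [hZK σ hσ x hx, hdZK σ hσ x hx, zero_mul, zero_mul, add_zero, mul_zero]
  -- the linear time-integration identity of part 1
  have h1 := integral_Ioo_integral_mul_timeDerivWithin hP hT hφ₀c hφ₀s hs hst ht
  have htI : t ∈ Icc 0 T := ⟨hs.trans hst, ht⟩
  have hsI : s ∈ Icc 0 T := ⟨hs, hst.trans ht⟩
  simp only [hplat t htI, hplat s hsI] at h1
  rw [← h1]
  refine setIntegral_congr_fun measurableSet_Ioo fun τ hτ => ?_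
  have hτ' : τ ∈ Icc 0 T := ⟨hs.trans hτ.1.le, hτ.2.le.trans ht⟩
  simp only [hplat' τ hτ']
  -- split and treat the transport piece by part 1
  have hZ1 : ContDiff ℝ 1 (Z τ) := (hZ.contDiff_slice hτ').of_le (by norm_cast)
  have hZc : HasCompactSupport (Z τ) := HasCompactSupport.intro hK fun x hx => hZK τ hτ' x hx
  have hWc : Continuous (angVortQuot (v τ)) := (hWfam.contDiff_slice hτ').continuous
  have hdZc : Continuous (FluidPDE.timeDerivWithin (Icc 0 T) Z τ) := ((hZ.timeDerivWithin hU).contDiff_slice hτ').continuous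
  have hdZs : HasCompactSupport (FluidPDE.timeDerivWithin (Icc 0 T) Z τ) := HasCompactSupport.intro hK fun x hx => hdZK τ hτ' x hx
  have hdWc : Continuous (FluidPDE.timeDerivWithin (Icc 0 T) (fun σ => angVortQuot (v σ)) τ) :=
    ((hWfam.timeDerivWithin hU).contDiff_slice hτ').continuous
  have hi1 : Integrable fun x => FluidPDE.timeDerivWithin (Icc 0 T) Z τ x * angVortQuot (v τ) x :=
    (hdZc.mul hWc).integrable_of_hasCompactSupport hdZs.mul_right
  have hi2 : Integrable fun x => Z τ x * FluidPDE.timeDerivWithin (Icc 0 T) (fun σ => angVortQuot (v σ)) τ x :=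
    (hZ1.continuous.mul hdWc).integrable_of_hasCompactSupport hZc.mul_right
  have hvc : Continuous (v τ) := (hv.contDiff_velocity hτ').continuous
  have hi3 : Integrable fun x => angVortQuot (v τ) x * FluidPDE.timeDerivWithin (Icc 0 T) Z τ x :=
    (hWc.mul hdZc).integrable_of_hasCompactSupport hdZs.mul_left
  have hi4 : Integrable fun x => angVortQuot (v τ) x * fderiv ℝ (Z τ) x (v τ x) := by
    refine (hWc.mul ((hZ1.continuous_fderiv one_ne_zero).clm_apply hvc)).integrable_of_hasCompactSupport ?_
    refine (hZc.fderiv (𝕜 := ℝ)).mono' fun x hx => ?_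
    contrapose! hx
    simp [image_eq_zero_of_notMem_tsupport hx]
  rw [integral_add hi1 hi2, integral_weight_mul_timeDerivWithin_angVortQuot hT hv hax hsw hτ' hZ1 hZc]
  rw [show (fun x => angVortQuot (v τ) x * (FluidPDE.timeDerivWithin (Icc 0 T) Z τ x + fderiv ℝ (Z τ) x (v τ x))) =
      fun x => angVortQuot (v τ) x * FluidPDE.timeDerivWithin (Icc 0 T) Z τ x + angVortQuot (v τ) x * fderiv ℝ (Z τ) x (v τ x)
      from funext fun x => by ring, integral_add hi3 hi4]
  congr 1
  exact integral_congr_ae (Eventually.of_forall fun x => by ring)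

end Summit.NavierStokesRegularity.NavierStokesRegularity.Theorems.PowerGaugeEulerLiouville.MirrorMoment

end
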